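import Summits.QuantumFields.QCD.Theorems.SpectralDefectExtinctionWindowExtinctionCornerSingleLinkWeightSup
import Summits.QuantumFields.QCD.Theorems.SpectralDefectExtinctionWindowExtinctionCornerSingleLinkDetCircle
import Summits.QuantumFields.QCD.Theorems.SpectralDefectExtinctionWindowExtinctionCornerSingleLinkHolonomyCircle
import Summits.QuantumFields.QCD.Theorems.SpectralDefectExtinctionWindowExtinctionCornerSingleLinkPhaseMatrix
import Summits.QuantumFields.QCD.Theorems.SpectralDefectExtinctionWindowExtinctionCornerSingleLinkRigidity
import Summits.QuantumFields.QCD.Theorems.SpectralDefectExtinctionWegnerEstimateCoareaCircleMajorant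
import Summits.QuantumFields.QCD.Theorems.SpectralDefectExtinctionWegnerEstimateCoareaSu3Circles
import Literature.MathematicalPhysics.QuantumFieldTheory.TorusFreeTransfer

/-!
# Stub `stub_singleLinkResonance` (S2c) of line `corner-decorrelation-deep-hole` — single-link resonance
anti-concentration (crux `SpectralDefectExtinction.WindowExtinction`, item stmt-QuantumFields-18063)

THE probabilistic input of the line (registered signature, proved): for `N_f ≤ 3`, `β ≥ 1`, `L ≥ 2`, any masses,
exterior, site `z`, phase `φ₀`, width `0 < ε ≤ 1` and bounded measurable `G ≥ 0` blind to the link `(z, 0)`: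
`∫ G·1[ρ(U_{P₀₁(z)}) has a root within ε of e^{iφ₀}]·W ≤ C √β ε ∫ G·W`, `W = e^{−βS_W} ∏_f |det D_W(·, μ_f, 1)|`.
Proof = the 1-D circle route of the Wegner line (`ResolventCell.coareaWegner_*`) on the `3 × 3` phase matrix
`S(U) = (−i/2)(e^{−iφ₀}ρ(U_P) − e^{iφ₀}ρ(U_P)ᴴ)`: resonance ⇒ `|λ_j(S)| ≤ ε` (brick D); `su(3)` rigidity along the
eight circles of the link (`cornerSL_point_rigidity`) ⇒ `1[res] ≤ 4ε Σ_i R_i` a.e. (canonical circle majorants);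
slice lemma + weight sup bound along circles (bricks A, B, C: `W(U_t) ≤ K√β ∫_s W(U_s)`) + area bound
`∫_t R_i(U_t) ≤ 4656π` (bricks D, D′); slice lemma backwards.
-/

noncomputable section

namespace Summit.QuantumFields.QCD.Cruxes.WindowExtinction.CornerDecorrelationDeepHole

open scoped BigOperators Matrix ENNReal NNReal ComplexConjugate ComplexOrder Real
open Matrix MeasureTheory Complex Polynomial
open Literature.MathematicalPhysics.QuantumLattice Literature.MathematicalPhysics.QuantumFieldTheory
  Literature.Probability.LatticeModels
open Summit.QuantumFields.QCD.Cruxes.WegnerEstimate.ResolventCell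

/-- `ofReal (∫ f) ≤ ∫⁻ ofReal f` for `f ≥ 0` (if `f` is not integrable the left side is `0`). -/
theorem cornerSL_ofReal_integral_le_lintegral {α : Type*} [MeasurableSpace α] {μ : Measure α}
    {f : α → ℝ} (hf : ∀ a, 0 ≤ f a) :
    ENNReal.ofReal (∫ a, f a ∂μ) ≤ ∫⁻ a, ENNReal.ofReal (f a) ∂μ := by
  by_cases hfm : AEStronglyMeasurable f μ
  · rw [integral_eq_lintegral_of_nonneg_ae (Filter.Eventually.of_forall hf) hfm]
    exact ENNReal.ofReal_toReal_le
  · rw [integral_non_aestronglyMeasurable hfm, ENNReal.ofReal_zero]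
    exact zero_le

/-- The Wegner window dominates the indicator of `[−ε, ε]`: `|x| ≤ ε ⇒ 1 ≤ 2ε · ε/(x² + ε²)`. -/
theorem cornerSL_window_ge {x ε : ℝ} (hε : 0 < ε) (hx : |x| ≤ ε) : 1 ≤ 2 * ε * (ε / (x ^ 2 + ε ^ 2)) := by
  have hx2 : x ^ 2 ≤ ε ^ 2 := by rw [← sq_abs]; exact pow_le_pow_left₀ (abs_nonneg x) hx 2
  have hpos : 0 < x ^ 2 + ε ^ 2 := by positivity
  rw [mul_div_assoc', le_div_iff₀ hpos]
  nlinarith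

/-- **S2c · SINGLE-LINK RESONANCE ANTI-CONCENTRATION** (registered stub `stub_singleLinkResonance` of line
`corner-decorrelation-deep-hole`, crux `WindowExtinction`, item stmt-QuantumFields-18063). -/
theorem stub_singleLinkResonance :
    ∃ C : ℝ, 0 < C ∧ ∀ Nf : ℕ, Nf ≤ 3 → ∀ β : ℝ, 1 ≤ β → ∀ (L : ℕ) [NeZero L], 2 ≤ L →
    ∀ (μ : Fin Nf → ℝ) (z : TorusSite 4 L) (φ₀ ε : ℝ), 0 < ε → ε ≤ 1 →
    ∀ (G : GaugeConfig 4 L SU3 → ℝ) (B : ℝ), Measurable G → (∀ U, 0 ≤ G U ∧ G U ≤ B) →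
    (∀ (U : GaugeConfig 4 L SU3) (g : SU3), G (Function.update U (z, 0) g) = G U) →
    ∫ U, G U * (if 1 ≤ Multiset.countP (fun w : ℂ => ‖w - Complex.exp (↑φ₀ * Complex.I)‖ ≤ ε)
    (fundamentalRep (Fin 3) (plaquetteHolonomy U z 0 1)).charpoly.roots then (1 : ℝ) else 0) *
    (Real.exp (-(β * wilsonAction (fundamentalRep (Fin 3)) U)) *
    ∏ f, ‖fermionDet (wilsonDirac (fundamentalRep (Fin 3)) U (μ f) 1)‖)
    ∂(Measure.pi fun _ : Edge 4 L => haarProbability SU3) ≤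
    C * Real.sqrt β * ε *
    ∫ U, G U * (Real.exp (-(β * wilsonAction (fundamentalRep (Fin 3)) U)) *
    ∏ f, ‖fermionDet (wilsonDirac (fundamentalRep (Fin 3)) U (μ f) 1)‖)
    ∂(Measure.pi fun _ : Edge 4 L => haarProbability SU3) := by
  obtain ⟨m, hm⟩ : ∃ m : ℕ, m = 144 := ⟨_, rfl⟩
  obtain ⟨K₀, hK₀0, hK₀eq⟩ : ∃ K₀ : ℝ, 0 < K₀ ∧ ∀ κ : ℝ,
      3 * (50 * (m : ℝ) + 51) ^ m * Real.sqrt (1 + κ) = K₀ * Real.sqrt (1 + κ) :=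
    ⟨3 * (50 * (m : ℝ) + 51) ^ m, by positivity, fun κ => rfl⟩
  obtain ⟨K₁, hK₁⟩ : ∃ K₁ : ℝ, K₁ = K₀ * 21 := ⟨_, rfl⟩
  have hK₁0 : 0 < K₁ := by rw [hK₁]; positivity
  obtain ⟨C₀, hC₀⟩ : ∃ C₀ : ℝ, C₀ = 4 * 8 * K₁ * (4656 * Real.pi) := ⟨_, rfl⟩
  have hC₀0 : 0 < C₀ := by rw [hC₀]; positivity
  refine ⟨C₀ + 2, by positivity, ?_⟩
  intro Nf hNf β hβ L _ hL μ z φ₀ ε hε hε1 G B hGm hGB hGblind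
  have hβ0 : 0 ≤ β := by linarith
  set π₀ : Measure (GaugeConfig 4 L SU3) := Measure.pi fun _ : Edge 4 L => haarProbability SU3 with hπ₀
  set ρ := fundamentalRep (Fin 3) with hρdef
  set W : GaugeConfig 4 L SU3 → ℝ := fun U =>
    Real.exp (-(β * wilsonAction ρ U)) * ∏ f, ‖fermionDet (wilsonDirac ρ U (μ f) 1)‖ with hW
  set res : GaugeConfig 4 L SU3 → ℝ := fun U =>
    if 1 ≤ Multiset.countP (fun w : ℂ => ‖w - Complex.exp (↑φ₀ * Complex.I)‖ ≤ ε)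
      (ρ (plaquetteHolonomy U z 0 1)).charpoly.roots then (1 : ℝ) else 0 with hres
  have hW0 : ∀ U, 0 ≤ W U := fun U => mul_nonneg (Real.exp_pos _).le (Finset.prod_nonneg fun f _ => norm_nonneg _)
  have hres01 : ∀ U, 0 ≤ res U ∧ res U ≤ 1 := fun U => by
    simp only [hres]; split_ifs <;> norm_num
  have hWc : Continuous W := by
    refine (Real.continuous_exp.comp ((continuous_wilsonAction ρ (continuous_fundamentalRep (Fin 3))).const_mul
      β).neg).mul (continuous_finsetProd _ fun f _ => ?_)
    exact ((continuous_wilsonDirac ρ (continuous_fundamentalRep (Fin 3)) (μ f) 1).matrix_det).norm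
  have hWm : Measurable W := hWc.measurable
  have hGWi : Integrable (fun U => G U * W U) π₀ := by
    obtain ⟨Wmax, hWmax⟩ : ∃ Wmax, ∀ U, W U ≤ Wmax := by
      obtain ⟨x, -, hx⟩ := isCompact_univ.exists_isMaxOn Set.univ_nonempty hWc.continuousOn
      exact ⟨W x, fun U => hx (Set.mem_univ U)⟩
    refine Integrable.of_bound ((hGm.mul hWm).aestronglyMeasurable) (B * Wmax) (ae_of_all _ fun U => ?_)
    rw [Real.norm_eq_abs, abs_of_nonneg (mul_nonneg (hGB U).1 (hW0 U))]
    exact mul_le_mul (hGB U).2 (hWmax U) (hW0 U) ((hGB U).1.trans (hGB U).2)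
  have hGW0 : 0 ≤ ∫ U, G U * W U ∂π₀ := integral_nonneg fun U => mul_nonneg (hGB U).1 (hW0 U)
  show ∫ U, G U * res U * W U ∂π₀ ≤ (C₀ + 2) * Real.sqrt β * ε * ∫ U, G U * W U ∂π₀
  have hsqrt1 : 1 ≤ Real.sqrt β := by
    calc (1 : ℝ) = Real.sqrt 1 := Real.sqrt_one.symm
      _ ≤ Real.sqrt β := Real.sqrt_le_sqrt hβ
  have htriv : ∫ U, G U * res U * W U ∂π₀ ≤ ∫ U, G U * W U ∂π₀ :=
    integral_mono_of_nonneg (ae_of_all _ fun U => mul_nonneg (mul_nonneg (hGB U).1 (hres01 U).1) (hW0 U))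
      hGWi (ae_of_all _ fun U => by
        calc G U * res U * W U ≤ G U * 1 * W U :=
              mul_le_mul_of_nonneg_right (mul_le_mul_of_nonneg_left (hres01 U).2 (hGB U).1) (hW0 U)
          _ = G U * W U := by rw [mul_one])
  by_cases hεhalf : 1 / 2 < ε
  · calc ∫ U, G U * res U * W U ∂π₀ ≤ ∫ U, G U * W U ∂π₀ := htriv
      _ = 1 * ∫ U, G U * W U ∂π₀ := (one_mul _).symm
      _ ≤ (C₀ + 2) * Real.sqrt β * ε * ∫ U, G U * W U ∂π₀ := by
          refine mul_le_mul_of_nonneg_right ?_ hGW0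
          nlinarith [mul_le_mul hsqrt1 hεhalf.le (by norm_num) (Real.sqrt_nonneg β), hC₀0.le,
            Real.sqrt_nonneg β]
  push Not at hεhalf
  let e : Edge 4 L := (z, 0)
  let a : ℂ := Complex.exp (-(↑φ₀ * Complex.I))
  let Mm : GaugeConfig 4 L SU3 → Matrix (Fin 3) (Fin 3) ℂ := fun U => ((U e : SU3) : Matrix (Fin 3) (Fin 3) ℂ)
  let Nm : GaugeConfig 4 L SU3 → Matrix (Fin 3) (Fin 3) ℂ := fun U =>
    (((U (Site.shift z 0, 1) * (U (Site.shift z 1, 0))⁻¹ * (U (z, 1))⁻¹ : SU3)) : Matrix (Fin 3) (Fin 3) ℂ)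
  let Y : GaugeConfig 4 L SU3 → Matrix (Fin 3) (Fin 3) ℂ := fun U =>
    ((plaquetteHolonomy U z 0 1 : SU3) : Matrix (Fin 3) (Fin 3) ℂ)
  let phase : Matrix (Fin 3) (Fin 3) ℂ → Matrix (Fin 3) (Fin 3) ℂ := fun X =>
    (-Complex.I / 2) • (a • X - (starRingEnd ℂ a) • Xᴴ)
  let Hof : GaugeConfig 4 L SU3 → Matrix (Fin 3) (Fin 3) ℂ := fun U => phase (Y U)
  have hHerm : ∀ U, (Hof U).IsHermitian := fun U => cornerSL_phase_isHermitian (Y U) a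
  have hHofc : Continuous Hof := cornerSL_phase_continuous z a
  have hYMN : ∀ U, Y U = Mm U * Nm U := fun U => by
    show ((plaquetteHolonomy U z 0 1 : SU3) : Matrix (Fin 3) (Fin 3) ℂ) = _
    rw [cornerSL_holonomy_eq hL U z, Submonoid.coe_mul]
  have hMu : ∀ U, Mm U ∈ Matrix.unitaryGroup (Fin 3) ℂ := fun U =>
    Matrix.specialUnitaryGroup_le_unitaryGroup (U e).2
  have hNu : ∀ U, Nm U ∈ Matrix.unitaryGroup (Fin 3) ℂ := fun U =>
    Matrix.specialUnitaryGroup_le_unitaryGroup (U (Site.shift z 0, 1) * (U (Site.shift z 1, 0))⁻¹ * (U (z, 1))⁻¹).2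
  have hYu : ∀ U, Y U ∈ Matrix.unitaryGroup (Fin 3) ℂ := fun U =>
    Matrix.specialUnitaryGroup_le_unitaryGroup (plaquetteHolonomy U z 0 1).2
  choose cf hcδ hc0 hcmul hcper hccont hcderiv using coareaWegner_su3Circles
  choose δ₀ δ₁ δ₂ hcδ' using hcδ
  have hδ₂ : ∀ i, δ₂ i = su3Basis i := by
    intro i
    ext p q
    have h1 : HasDerivAt (fun t => ((cf i t : SU3) : Matrix (Fin 3) (Fin 3) ℂ) p q)
        ((((-Real.sin 0 : ℝ) : ℂ) • δ₁ i + ((Real.cos 0 : ℝ) : ℂ) • δ₂ i) p q) 0 := by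
      have hfun : (fun t => ((cf i t : SU3) : Matrix (Fin 3) (Fin 3) ℂ) p q) =
          fun t => (δ₀ i + ((Real.cos t : ℝ) : ℂ) • δ₁ i + ((Real.sin t : ℝ) : ℂ) • δ₂ i) p q := by
        funext t; rw [hcδ' i t]
      rw [hfun]
      exact coareaWegner_trigFamily_hasDerivAt _ _ _ 0 p q
    have h2 := h1.unique (hcderiv i p q)
    simp only [Real.sin_zero, Real.cos_zero, neg_zero, Complex.ofReal_zero, Complex.ofReal_one, zero_smul,
      one_smul, zero_add] at h2
    rw [h2]
    rfl
  let Hk : Fin 8 → GaugeConfig 4 L SU3 → Matrix (Fin 3) (Fin 3) ℂ → Matrix (Fin 3) (Fin 3) ℂ :=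
    fun i U δ => phase (Mm U * δ * Nm U)
  have hfam : ∀ i U (s : ℝ), Hof (Function.update U e (U e * cf i s)) =
      Hk i U (δ₀ i) + ((Real.cos s : ℝ) : ℂ) • Hk i U (δ₁ i) + ((Real.sin s : ℝ) : ℂ) • Hk i U (δ₂ i) :=
    fun i U s => cornerSL_phase_circle hL U z (cf i) (δ₀ i) (δ₁ i) (δ₂ i) (hcδ' i) a s
  let φw : ℝ → ℝ := fun E => ε / (E ^ 2 + ε ^ 2)
  have hφc : Continuous φw := by
    refine continuous_const.div (by fun_prop) fun E => ?_
    positivity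
  have hφ0 : ∀ E, 0 ≤ φw E := fun E => by positivity
  let Hd : Fin 8 → GaugeConfig 4 L SU3 → Matrix (Fin 3) (Fin 3) ℂ := fun i U =>
    ((-Real.sin 0 : ℝ) : ℂ) • Hk i U (δ₁ i) + ((Real.cos 0 : ℝ) : ℂ) • Hk i U (δ₂ i)
  have hHd' : ∀ i U, Hd i U = phase (Mm U * su3Basis i * Nm U) := by
    intro i U
    show ((-Real.sin 0 : ℝ) : ℂ) • Hk i U (δ₁ i) + ((Real.cos 0 : ℝ) : ℂ) • Hk i U (δ₂ i) = _
    rw [Real.sin_zero, Real.cos_zero, neg_zero, Complex.ofReal_zero, Complex.ofReal_one, zero_smul, one_smul,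
      zero_add, hδ₂ i]
  let J : Fin 8 → GaugeConfig 4 L SU3 → (Fin 3 → ℂ) → ℝ := fun i U ψ => (star ψ ⬝ᵥ (Hd i U) *ᵥ ψ).re
  let Rd : Fin 8 → GaugeConfig 4 L SU3 → ℝ := fun i U => ∑ k : Fin (Fintype.card (Fin 3)),
    |deriv (fun s => (hHerm (Function.update U e (U e * cf i s))).eigenvalues₀ k) 0| *
      φw ((hHerm U).eigenvalues₀ k)
  have hRd0 : ∀ i U, 0 ≤ Rd i U := fun i U => Finset.sum_nonneg fun k _ => mul_nonneg (abs_nonneg _) (hφ0 _)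
  have hdiffH : ∀ i U, ∃ Hd' : Matrix (Fin 3) (Fin 3) ℂ, ∀ p q,
      HasDerivAt (fun s => Hof (Function.update U e (U e * cf i s)) p q) (Hd' p q) 0 := by
    intro i U
    refine ⟨Hd i U, fun p q => ?_⟩
    have hfun : (fun s => Hof (Function.update U e (U e * cf i s)) p q) = fun s =>
        (Hk i U (δ₀ i) + ((Real.cos s : ℝ) : ℂ) • Hk i U (δ₁ i) + ((Real.sin s : ℝ) : ℂ) • Hk i U (δ₂ i)) p q := by
      funext s; rw [hfam i U s]
    rw [hfun]
    exact coareaWegner_trigFamily_hasDerivAt _ _ _ 0 p q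
  have hJd : ∀ i U (ψ : Fin 3 → ℂ), HasDerivAt
      (fun s => (star ψ ⬝ᵥ (Hof (Function.update U e (U e * cf i s))).mulVec ψ).re) (J i U ψ) 0 := by
    intro i U ψ
    refine coareaWegner_rayleigh_matrix_hasDerivAt (fun s => Hof (Function.update U e (U e * cf i s)))
      (Hd i U) 0 (fun p q => ?_) ψ
    have hfun : (fun s => Hof (Function.update U e (U e * cf i s)) p q) = fun s =>
        (Hk i U (δ₀ i) + ((Real.cos s : ℝ) : ℂ) • Hk i U (δ₁ i) + ((Real.sin s : ℝ) : ℂ) • Hk i U (δ₂ i)) p q := by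
      funext s; rw [hfam i U s]
    rw [hfun]
    exact coareaWegner_trigFamily_hasDerivAt _ _ _ 0 p q
  have hlip : ∀ i U, ∃ K : ℝ≥0, ∀ k : Fin (Fintype.card (Fin 3)),
      LipschitzWith K fun s => (hHerm (Function.update U e (U e * cf i s))).eigenvalues₀ k := fun i U =>
    ⟨_, fun k => coareaWegner_eigenvalues₀_lipschitz (fun s => Hof (Function.update U e (U e * cf i s)))
      (fun s => hHerm _) (fun s t p q => by
        rw [hfam i U s, hfam i U t]; exact coareaWegner_trigFamily_lipschitz_const _ _ _ s t p q) k⟩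
  have hae : ∀ᵐ U ∂π₀, ∀ i, ∑ j : Fin 3, |J i U ⇑((hHerm U).eigenvectorBasis j)| * φw ((hHerm U).eigenvalues j) =
      Rd i U := by
    rw [hπ₀]
    exact ae_all_iff.2 fun i => coareaWegner_circleMajorant_ae_eq e Hof hHerm (hc0 i) (hcmul i) (hccont i) hHofc
      (hlip i) (hdiffH i) (J i) (hJd i) φw
  have hRdm : ∀ i, Measurable fun U => ENNReal.ofReal (Rd i U) := fun i =>
    coareaWegner_majorant_measurable e Hof hHerm (hccont i) hHofc φw hφc
  have hpt : ∀ U, res U ≤ 4 * ε * ∑ i, ∑ j : Fin 3,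
      |J i U ⇑((hHerm U).eigenvectorBasis j)| * φw ((hHerm U).eigenvalues j) := by
    intro U
    have hsum0 : 0 ≤ ∑ i, ∑ j : Fin 3, |J i U ⇑((hHerm U).eigenvectorBasis j)| * φw ((hHerm U).eigenvalues j) :=
      Finset.sum_nonneg fun i _ => Finset.sum_nonneg fun j _ => mul_nonneg (abs_nonneg _) (hφ0 _)
    simp only [hres]
    split_ifs with hcount
    · -- a resonant root
      obtain ⟨w, hw, hwε⟩ := Multiset.countP_pos.1 hcount
      have hYU : ρ (plaquetteHolonomy U z 0 1) = Y U := rfl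
      rw [hYU] at hw
      obtain ⟨j, hj⟩ := cornerSL_phase_resonance (Y U) (hYu U) φ₀ ε w hw hwε (hHerm U)
      set u : Fin 3 → ℂ := ⇑((hHerm U).eigenvectorBasis j) with hu
      have hu1 : star u ⬝ᵥ u = 1 := coareaWegner_star_dotProduct_eigenvectorBasis (hHerm U) j
      have hHu : phase (Mm U * Nm U) *ᵥ u = (((hHerm U).eigenvalues j : ℝ) : ℂ) • u := by
        rw [← hYMN U]
        exact coareaWegner_mulVec_eigenvectorBasis (hHerm U) j
      have hrig := cornerSL_point_rigidity (Mm U) (Nm U) (hMu U) (hNu U) φ₀ u hu1 ((hHerm U).eigenvalues j)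
        (hj.trans hεhalf) hHu
      have hJeq : ∀ i, J i U u = (star u ⬝ᵥ (((-Complex.I / 2) • (Complex.exp (-(φ₀ * Complex.I)) •
          (Mm U * su3Basis i * Nm U) - (starRingEnd ℂ (Complex.exp (-(φ₀ * Complex.I)))) •
          (Mm U * su3Basis i * Nm U)ᴴ)) *ᵥ u)).re := by
        intro i
        show (star u ⬝ᵥ (Hd i U) *ᵥ u).re = _
        rw [hHd' i U]
      have hrig' : 1 / 2 ≤ ∑ i, |J i U u| := by
        calc (1 / 2 : ℝ) ≤ _ := hrig
          _ = ∑ i, |J i U u| := Finset.sum_congr rfl fun i _ => by rw [hJeq i]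
      have hwin : 1 ≤ 2 * ε * φw ((hHerm U).eigenvalues j) := cornerSL_window_ge hε hj
      calc (1 : ℝ) ≤ (2 * ∑ i, |J i U u|) * (2 * ε * φw ((hHerm U).eigenvalues j)) := by
            nlinarith [Finset.sum_nonneg (fun i (_ : i ∈ (Finset.univ : Finset (Fin 8))) => abs_nonneg (J i U u)),
              hφ0 ((hHerm U).eigenvalues j)]
        _ = 4 * ε * ((∑ i, |J i U u|) * φw ((hHerm U).eigenvalues j)) := by ring
        _ = 4 * ε * ∑ i, |J i U u| * φw ((hHerm U).eigenvalues j) := by rw [Finset.sum_mul]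
        _ ≤ 4 * ε * ∑ i, ∑ j' : Fin 3, |J i U ⇑((hHerm U).eigenvectorBasis j')| * φw ((hHerm U).eigenvalues j') := by
            refine mul_le_mul_of_nonneg_left (Finset.sum_le_sum fun i _ => ?_) (by positivity)
            exact Finset.single_le_sum (f := fun j' => |J i U ⇑((hHerm U).eigenvectorBasis j')| *
              φw ((hHerm U).eigenvalues j')) (fun j' _ => mul_nonneg (abs_nonneg _) (hφ0 _)) (Finset.mem_univ j)
    · positivity
  have hstep2 : ∫⁻ U, ENNReal.ofReal (G U * res U * W U) ∂π₀ ≤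
      ENNReal.ofReal (4 * ε) * ∑ i, ∫⁻ U, ENNReal.ofReal (G U * W U) * ENNReal.ofReal (Rd i U) ∂π₀ := by
    have hmeas : ∀ i, Measurable fun U => ENNReal.ofReal (G U * W U) * ENNReal.ofReal (Rd i U) := fun i =>
      (hGm.mul hWm).ennreal_ofReal.mul (hRdm i)
    rw [← lintegral_finsetSum _ fun i _ => hmeas i, ← lintegral_const_mul' _ _ ENNReal.ofReal_ne_top]
    refine lintegral_mono_ae ?_
    filter_upwards [hae] with U hU
    have h1 : res U ≤ 4 * ε * ∑ i, Rd i U := by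
      calc res U ≤ _ := hpt U
        _ = 4 * ε * ∑ i, Rd i U := by rw [Finset.sum_congr rfl fun i _ => hU i]
    have hG0 := (hGB U).1
    calc ENNReal.ofReal (G U * res U * W U) ≤ ENNReal.ofReal (G U * (4 * ε * ∑ i, Rd i U) * W U) :=
          ENNReal.ofReal_le_ofReal (mul_le_mul_of_nonneg_right (mul_le_mul_of_nonneg_left h1 hG0) (hW0 U))
      _ = ENNReal.ofReal (4 * ε) * ∑ i, ENNReal.ofReal (G U * W U) * ENNReal.ofReal (Rd i U) := by
          rw [show G U * (4 * ε * ∑ i, Rd i U) * W U = (4 * ε) * ∑ i, (G U * W U) * Rd i U by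
            rw [Finset.mul_sum, Finset.mul_sum, Finset.mul_sum, Finset.sum_mul]
            exact Finset.sum_congr rfl fun i _ => by ring]
          rw [ENNReal.ofReal_mul (by positivity), ENNReal.ofReal_sum_of_nonneg
            (fun i _ => mul_nonneg (mul_nonneg hG0 (hW0 U)) (hRd0 i U))]
          congr 1
          exact Finset.sum_congr rfl fun i _ => ENNReal.ofReal_mul (mul_nonneg hG0 (hW0 U))
  have hsup : ∀ i U (t : ℝ), ENNReal.ofReal (W (Function.update U e (U e * cf i t))) ≤
      ENNReal.ofReal (K₁ * Real.sqrt β) *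
        ∫⁻ s in Set.Ioc 0 (2 * Real.pi), ENNReal.ofReal (W (Function.update U e (U e * cf i s))) := by
    intro i U t
    obtain ⟨Q, hQdeg, hQ⟩ := cornerSL_prod_fermionDet_circle_poly U μ z 0 (cf i) (δ₀ i) (δ₁ i) (δ₂ i) (hcδ' i)
    obtain ⟨A, κ, t₀, hκ0, hκ, hB⟩ := cornerSL_boltzmann_circle hL U e (cf i) (δ₀ i) (δ₁ i) (δ₂ i) (hcδ' i) hβ0
    have hWt : ∀ s, W (Function.update U e (U e * cf i s)) =
        ‖Q.eval (Complex.exp (s * Complex.I))‖ * Real.exp (A + κ * Real.cos (s - t₀)) := by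
      intro s
      simp only [hW]
      rw [hB s, hQ s, mul_comm]
    have hdeg : Q.natDegree ≤ m := hQdeg.trans (by omega)
    have hmain := cornerSL_weight_sup m Q hdeg A κ t₀ hκ0 t
    simp_rw [hWt]
    refine hmain.trans (mul_le_mul' (ENNReal.ofReal_le_ofReal ?_) le_rfl)
    have hsq : Real.sqrt (1 + κ) ≤ 21 * Real.sqrt β := by
      rw [show (21 : ℝ) = Real.sqrt (21 ^ 2) by rw [Real.sqrt_sq (by norm_num)], ← Real.sqrt_mul (by norm_num)]
      exact Real.sqrt_le_sqrt (by nlinarith)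
    rw [hK₀eq κ]
    calc K₀ * Real.sqrt (1 + κ) ≤ K₀ * (21 * Real.sqrt β) := mul_le_mul_of_nonneg_left hsq hK₀0.le
      _ = K₁ * Real.sqrt β := by rw [hK₁]; ring
  have harea : ∀ i U, ∫⁻ t in Set.Ioc 0 (2 * Real.pi), ENNReal.ofReal (Rd i (Function.update U e (U e * cf i t))) ≤
      ENNReal.ofReal (4656 * Real.pi) := by
    intro i U
    refine (coareaWegner_majorant_circle_lintegral e Hof hHerm (hcmul i) (hccont i) hHofc φw hφc hφ0 U).trans ?_
    exact cornerSL_trigFamily_areaBound (fun s => Hof (Function.update U e (U e * cf i s))) (fun s => hHerm _)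
      (Hk i U (δ₀ i)) (Hk i U (δ₁ i)) (Hk i U (δ₂ i)) (hfam i U) hε
  have hcurve : ∀ i (U : GaugeConfig 4 L SU3), Measurable fun t : ℝ => Function.update U e (U e * cf i t) := by
    intro i U
    have h1 : Continuous fun t : ℝ => U e * cf i t := continuous_const.mul (hccont i)
    have h2 : Continuous fun t : ℝ => Function.update U e (U e * cf i t) := continuous_const.update e h1
    exact h2.measurable
  have hstep4 : ∀ i, ∫⁻ U, ENNReal.ofReal (G U * W U) * ENNReal.ofReal (Rd i U) ∂π₀ ≤
      ENNReal.ofReal (K₁ * Real.sqrt β) * ENNReal.ofReal (4656 * Real.pi) *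
        ∫⁻ U, ENNReal.ofReal (G U * W U) ∂π₀ := by
    intro i
    have hF1 : Measurable fun U => ENNReal.ofReal (G U * W U) * ENNReal.ofReal (Rd i U) :=
      (hGm.mul hWm).ennreal_ofReal.mul (hRdm i)
    have hF2 : Measurable fun U => ENNReal.ofReal (G U * W U) := (hGm.mul hWm).ennreal_ofReal
    let IW : GaugeConfig 4 L SU3 → ℝ≥0∞ := fun U =>
      ∫⁻ s in Set.Ioc 0 (2 * Real.pi), ENNReal.ofReal (W (Function.update U e (U e * cf i s)))
    rw [hπ₀, coareaWegner_lintegral_pi_eq_circleAverage e (hccont i).measurable hF1]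
    have hper : ∀ U, ∫⁻ t in Set.Ioc 0 (2 * Real.pi),
        ENNReal.ofReal (G (Function.update U e (U e * cf i t)) * W (Function.update U e (U e * cf i t))) *
          ENNReal.ofReal (Rd i (Function.update U e (U e * cf i t))) ≤
        ENNReal.ofReal (G U) * IW U * (ENNReal.ofReal (K₁ * Real.sqrt β) * ENNReal.ofReal (4656 * Real.pi)) := by
      intro U
      have hGt : ∀ t, G (Function.update U e (U e * cf i t)) = G U := fun t => hGblind U _
      calc ∫⁻ t in Set.Ioc 0 (2 * Real.pi),
            ENNReal.ofReal (G (Function.update U e (U e * cf i t)) * W (Function.update U e (U e * cf i t))) *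
              ENNReal.ofReal (Rd i (Function.update U e (U e * cf i t)))
          ≤ ∫⁻ t in Set.Ioc 0 (2 * Real.pi), (ENNReal.ofReal (G U) * (ENNReal.ofReal (K₁ * Real.sqrt β) * IW U)) *
              ENNReal.ofReal (Rd i (Function.update U e (U e * cf i t))) := by
            refine lintegral_mono fun t => mul_le_mul' ?_ le_rfl
            rw [hGt t, ENNReal.ofReal_mul (hGB U).1]
            exact mul_le_mul' le_rfl (hsup i U t)
        _ = (ENNReal.ofReal (G U) * (ENNReal.ofReal (K₁ * Real.sqrt β) * IW U)) *
              ∫⁻ t in Set.Ioc 0 (2 * Real.pi), ENNReal.ofReal (Rd i (Function.update U e (U e * cf i t))) :=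
            lintegral_const_mul _ ((hRdm i).comp (hcurve i U))
        _ ≤ (ENNReal.ofReal (G U) * (ENNReal.ofReal (K₁ * Real.sqrt β) * IW U)) * ENNReal.ofReal (4656 * Real.pi) :=
            mul_le_mul' le_rfl (harea i U)
        _ = _ := by ring
    have h2π : ENNReal.ofReal (2 * Real.pi)⁻¹ * ENNReal.ofReal (2 * Real.pi) = 1 := by
      rw [← ENNReal.ofReal_mul (by positivity), inv_mul_cancel₀ (by positivity), ENNReal.ofReal_one]
    have hback : ∫⁻ U, ENNReal.ofReal (G U) * IW U ∂(Measure.pi fun _ : Edge 4 L => haarProbability SU3) =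
        ENNReal.ofReal (2 * Real.pi) * ∫⁻ U, ENNReal.ofReal (G U * W U) ∂π₀ := by
      have h1 : ∀ U, ENNReal.ofReal (G U) * IW U = ∫⁻ s in Set.Ioc 0 (2 * Real.pi),
          ENNReal.ofReal (G (Function.update U e (U e * cf i s)) * W (Function.update U e (U e * cf i s))) := by
        intro U
        have hm : Measurable fun s : ℝ => ENNReal.ofReal (W (Function.update U e (U e * cf i s))) :=
          hWm.ennreal_ofReal.comp (hcurve i U)
        show ENNReal.ofReal (G U) * (∫⁻ s in Set.Ioc 0 (2 * Real.pi),
          ENNReal.ofReal (W (Function.update U e (U e * cf i s)))) = _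
        rw [← lintegral_const_mul _ hm]
        refine lintegral_congr fun s => ?_
        rw [hGblind U, ENNReal.ofReal_mul (hGB U).1]
      simp_rw [h1]
      rw [hπ₀, coareaWegner_lintegral_pi_eq_circleAverage e (hccont i).measurable hF2, ← mul_assoc,
        mul_comm (ENNReal.ofReal (2 * Real.pi)), h2π, one_mul]
    calc ENNReal.ofReal (2 * Real.pi)⁻¹ * ∫⁻ U, (∫⁻ t in Set.Ioc 0 (2 * Real.pi),
            ENNReal.ofReal (G (Function.update U e (U e * cf i t)) * W (Function.update U e (U e * cf i t))) *
              ENNReal.ofReal (Rd i (Function.update U e (U e * cf i t))))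
            ∂(Measure.pi fun _ : Edge 4 L => haarProbability SU3)
        ≤ ENNReal.ofReal (2 * Real.pi)⁻¹ * ∫⁻ U, ENNReal.ofReal (G U) * IW U *
            (ENNReal.ofReal (K₁ * Real.sqrt β) * ENNReal.ofReal (4656 * Real.pi))
            ∂(Measure.pi fun _ : Edge 4 L => haarProbability SU3) :=
          mul_le_mul' le_rfl (lintegral_mono fun U => hper U)
      _ = ENNReal.ofReal (2 * Real.pi)⁻¹ * ((∫⁻ U, ENNReal.ofReal (G U) * IW U
            ∂(Measure.pi fun _ : Edge 4 L => haarProbability SU3)) *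
            (ENNReal.ofReal (K₁ * Real.sqrt β) * ENNReal.ofReal (4656 * Real.pi))) := by
          rw [lintegral_mul_const' _ _ (ENNReal.mul_ne_top ENNReal.ofReal_ne_top ENNReal.ofReal_ne_top)]
      _ = (ENNReal.ofReal (2 * Real.pi)⁻¹ * ENNReal.ofReal (2 * Real.pi)) *
            (∫⁻ U, ENNReal.ofReal (G U * W U) ∂π₀) *
            (ENNReal.ofReal (K₁ * Real.sqrt β) * ENNReal.ofReal (4656 * Real.pi)) := by
          rw [hback]; ring
      _ = ENNReal.ofReal (K₁ * Real.sqrt β) * ENNReal.ofReal (4656 * Real.pi) *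
            ∫⁻ U, ENNReal.ofReal (G U * W U) ∂π₀ := by
          rw [h2π, one_mul]; ring
  have hlint : ∫⁻ U, ENNReal.ofReal (G U * res U * W U) ∂π₀ ≤
      ENNReal.ofReal (C₀ * Real.sqrt β * ε) * ∫⁻ U, ENNReal.ofReal (G U * W U) ∂π₀ := by
    calc ∫⁻ U, ENNReal.ofReal (G U * res U * W U) ∂π₀
        ≤ ENNReal.ofReal (4 * ε) * ∑ i, ∫⁻ U, ENNReal.ofReal (G U * W U) * ENNReal.ofReal (Rd i U) ∂π₀ := hstep2
      _ ≤ ENNReal.ofReal (4 * ε) * ∑ _i : Fin 8, ENNReal.ofReal (K₁ * Real.sqrt β) * ENNReal.ofReal (4656 * Real.pi) *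
            ∫⁻ U, ENNReal.ofReal (G U * W U) ∂π₀ := by
          gcongr with i _
          exact hstep4 i
      _ = ENNReal.ofReal (C₀ * Real.sqrt β * ε) * ∫⁻ U, ENNReal.ofReal (G U * W U) ∂π₀ := by
          rw [Finset.sum_const, Finset.card_univ, Fintype.card_fin, nsmul_eq_mul, Nat.cast_ofNat]
          rw [show (8 : ℝ≥0∞) = ENNReal.ofReal 8 by simp, ← mul_assoc, ← mul_assoc, ← mul_assoc,
            ← ENNReal.ofReal_mul (by positivity), ← ENNReal.ofReal_mul (by positivity),
            ← ENNReal.ofReal_mul (by positivity)]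
          congr 2
          rw [hC₀]; ring
  have hfin : ∫⁻ U, ENNReal.ofReal (G U * W U) ∂π₀ = ENNReal.ofReal (∫ U, G U * W U ∂π₀) :=
    (ofReal_integral_eq_lintegral_ofReal hGWi (ae_of_all _ fun U => mul_nonneg (hGB U).1 (hW0 U))).symm
  have hreal : ∫ U, G U * res U * W U ∂π₀ ≤ C₀ * Real.sqrt β * ε * ∫ U, G U * W U ∂π₀ := by
    have h1 := (cornerSL_ofReal_integral_le_lintegral (μ := π₀)
      (fun U => mul_nonneg (mul_nonneg (hGB U).1 (hres01 U).1) (hW0 U))).trans hlint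
    rw [hfin, ← ENNReal.ofReal_mul (by positivity)] at h1
    exact (ENNReal.ofReal_le_ofReal_iff (by positivity)).1 h1
  calc ∫ U, G U * res U * W U ∂π₀ ≤ C₀ * Real.sqrt β * ε * ∫ U, G U * W U ∂π₀ := hreal
    _ ≤ (C₀ + 2) * Real.sqrt β * ε * ∫ U, G U * W U ∂π₀ := by
        refine mul_le_mul_of_nonneg_right ?_ hGW0
        have : 0 ≤ Real.sqrt β * ε := by positivity
        nlinarith

end Summit.QuantumFields.QCD.Cruxes.WindowExtinction.CornerDecorrelationDeepHole

end
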